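import Summits.CriticalPhenomena.PercolationContinuityZ3.Theorems.Transplant.SharpnessChiralSlabNet
import Summits.CriticalPhenomena.PercolationContinuityZ3.Theorems.Transplant.AutEndStateDefs
import HarnessLib

/-!
# EVERY PERIODIC NET ON `ℤ³` CARRIES THE END-STATE INPUT: the period lattice acts by translations (`Z3Net.shiftIso`) with finitely many orbits (the residue box), freely, and
# the character `v ↦ (v₀, v₁)` has rank two — so row 88's `G₈₈` (and every flat linked periodic net) is a customer of END-STATE CONTINUITY, with UNIT steps

builds on p205010 (kernel theorem, internal audit signed; external expert review pending) — nothing here uses p205010; NOTHING is claimed about any open node: the END-STATE node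
`BenjaminiSchramm1996_conj4_endState` (AutEndStateDefs :37, p4-g27) is OPEN and only taken as a HYPOTHESIS (`…_of_conj4_endState`); it is not this lane's rung (lead g21 V147 (C)).
Lane `prim-bschramm`, seat `prim-bschramm-p5` gen 24 (refuter; P5-SHARPNESS §54.16 — row 88's last column in the kernel; class B/C hypothesis-side row in p4's end-state programme).
Helper file (`--supports stmt-CriticalPhenomena-4575 --as helper`).
* §1 `Z3Net.periodSubgroup n` (the period lattice as an additive subgroup), `shiftHom` (`v ↦ shiftIso v` as a monoid homomorphism from `Multiplicative (periodSubgroup n)` into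
  `Aut`, injective), the rank-two character `projChar` (`v ↦ (v₀, v₁)`);
* §2 **`Z3Net.exists_endState_input`**: for every net with positive periods `n`, `∃ A₀ reps c` with the three end-state hypotheses (orbits through the residue box `typesBox n`;
  free action ⟹ stabilisers killed; `det2 (c (n₀e₀)) (c (n₁e₁)) = n₀ n₁ ≠ 0`); **`Z3Net.criticalContinuity_of_conj4_endState`** (connected periodic net ⟹ `θ_x(p_c) = 0` at
  every vertex, MODULO end-state continuity); `Z3Net.criticalContinuity_of_flat_of_conj4_endState` (flat linked periodic planar-range-1 nets: connectedness from `skeletonFrm`);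
* §3 **`ChiralNet.criticalContinuity_of_conj4_endState`** — `G₈₈` (3 inhomogeneous types, no one-type skeleton, no centred symmetry) is an end-state customer with UNIT steps.
[cite: BenjaminiSchramm1996, Conj. 4; §2 (quasi-transitive graphs)] [cite: KozmaNitzan2024, §4 p. 16 (Lemma 8: the role of the lattice symmetries)]
-/

noncomputable section

namespace Summit.CriticalPhenomena.PercolationContinuityZ3.Theorems.Transplant

open SimpleGraph Literature.Probability.LatticeModels Literature.Probability.Percolation Multiplicative
open Literature.Barriers.CriticalPhenomena (IsQuasiTransitive)
open Z3Diag (ev proj proj_add proj_sub)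

namespace Z3Net

variable (N : Z3Net)

/-! ## §1 The period lattice as a subgroup; translations as a homomorphism into `Aut`; the character -/

/-- **The period lattice `∏ nᵢℤ` as an additive subgroup of `ℤ³`.** [folklore] -/
def periodSubgroup (n : Fin 3 → ℕ) : AddSubgroup (Site 3) where
  carrier := periodLattice n
  add_mem' := add_mem_periodLattice
  zero_mem' := fun i => ⟨0, by simp⟩
  neg_mem' := neg_mem_periodLattice

/-- Membership in `periodSubgroup`. [folklore] -/
theorem mem_periodSubgroup {n : Fin 3 → ℕ} {v : Site 3} : v ∈ periodSubgroup n ↔ v ∈ periodLattice n := Iff.rfl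

/-- **Translations by the period lattice, as a homomorphism into `Aut(N)`** (injective: evaluate at `0`). [cite: BenjaminiSchramm1996, §2] -/
def shiftHom {n : Fin 3 → ℕ} (h : N.Periodic n) : Multiplicative (periodSubgroup n) →* (N.graph ≃g N.graph) where
  toFun v := N.shiftIso h (toAdd v).1 (toAdd v).2
  map_one' := RelIso.ext fun x => by
    show x + (((toAdd (1 : Multiplicative (periodSubgroup n))) : periodSubgroup n) : Site 3) = x
    simp
  map_mul' v w := RelIso.ext fun x => by
    show x + ((toAdd (v * w) : periodSubgroup n) : Site 3) = (x + ((toAdd w : periodSubgroup n) : Site 3)) + ((toAdd v : periodSubgroup n) : Site 3)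
    rw [toAdd_mul, AddSubgroup.coe_add, add_assoc, add_comm ((toAdd w : periodSubgroup n) : Site 3)]

/-- The translation, evaluated. [folklore] -/
@[simp] theorem shiftHom_apply {n : Fin 3 → ℕ} (h : N.Periodic n) (v : Multiplicative (periodSubgroup n)) (x : Site 3) :
    N.shiftHom h v x = x + ((toAdd v : periodSubgroup n) : Site 3) := rfl

/-- `shiftHom` is injective. [folklore] -/
theorem shiftHom_injective {n : Fin 3 → ℕ} (h : N.Periodic n) : Function.Injective (N.shiftHom h) := by
  intro v w hvw
  have h0 := congrArg (fun e : N.graph ≃g N.graph => e 0) hvw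
  simp only [shiftHom_apply, zero_add] at h0
  exact toAdd.injective (Subtype.ext h0)

/-- **The character `v ↦ (v₀, v₁)`** on the period lattice (multiplicative form). [folklore] -/
def projChar (n : Fin 3 → ℕ) : Multiplicative (periodSubgroup n) →* Multiplicative (Site 2) :=
  AddMonoidHom.toMultiplicative ((AddMonoidHom.mk' proj proj_add).comp (periodSubgroup n).subtype)

/-- The character, evaluated. [folklore] -/
@[simp] theorem toAdd_projChar {n : Fin 3 → ℕ} (v : Multiplicative (periodSubgroup n)) :
    toAdd (projChar n v) = proj ((toAdd v : periodSubgroup n) : Site 3) := rfl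

/-! ## §2 The end-state input of a periodic net -/

/-- The period multiple `nᵢ eᵢ` lies in the period lattice. [folklore] -/
theorem smul_ev_mem_periodLattice (n : Fin 3 → ℕ) (i : Fin 3) : ((n i : ℤ) • ev i : Site 3) ∈ periodLattice n := by
  intro j
  by_cases hji : j = i
  · subst hji; exact ⟨1, by simp [ev]⟩
  · exact ⟨0, by simp [ev, hji]⟩

/-- **THE END-STATE INPUT OF A PERIODIC NET**: `A₀ :=` the period-lattice translations (a subgroup of `Aut(N)`), `reps :=` the residue box, `c := (v₀, v₁)`: finitely many
orbits, every stabiliser killed (the action is free), rank two (`det2 = n₀ n₁ ≠ 0`). [cite: BenjaminiSchramm1996, §2 (quasi-transitive graphs)] [cite: KozmaNitzan2024, §4 p. 16] -/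
theorem exists_endState_input {n : Fin 3 → ℕ} (h : N.Periodic n) (hn : ∀ i, 0 < n i) :
    ∃ (A₀ : Subgroup (N.graph ≃g N.graph)) (reps : Finset (Site 3)) (c : A₀ →* Multiplicative (Site 2)),
      (∀ w : Site 3, ∃ a : A₀, ∃ s ∈ reps, (a : N.graph ≃g N.graph) s = w) ∧
      (∀ (a : A₀) (w : Site 3), (a : N.graph ≃g N.graph) w = w → c a = 1) ∧
      ∃ a b : A₀, MaxArea.det2 (toAdd (c a)) (toAdd (c b)) ≠ 0 := by
  set L := N.shiftHom h with hL
  have hLinj : Function.Injective L := N.shiftHom_injective h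
  let e : Multiplicative (periodSubgroup n) ≃* L.range := MonoidHom.ofInjective hLinj
  have he : ∀ v, ((e v : L.range) : N.graph ≃g N.graph) = L v := fun v => rfl
  let c : L.range →* Multiplicative (Site 2) := (projChar n).comp e.symm.toMonoidHom
  have hc : ∀ v, c (e v) = projChar n v := fun v => by
    show projChar n (e.symm (e v)) = _; rw [MulEquiv.symm_apply_apply]
  -- the lattice element `v` as an element of `Multiplicative (periodSubgroup n)`
  let ι : ∀ v : Site 3, v ∈ periodLattice n → Multiplicative (periodSubgroup n) := fun v hv => ofAdd ⟨v, hv⟩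
  have hι : ∀ v hv x, L (ι v hv) x = x + v := fun v hv x => rfl
  refine ⟨L.range, typesBox n, c, fun w => ?_, fun a w haw => ?_, ?_⟩
  · -- orbits: `w = residue w + (w − residue w)`
    refine ⟨e (ι (w - residue n w) (sub_residue_mem_periodLattice n w)), residue n w, residue_mem_typesBox hn w, ?_⟩
    rw [he, hι]; abel
  · -- free action: `w + v = w ⟹ v = 0 ⟹ a = 1`
    have ha : a = e (e.symm a) := (MulEquiv.apply_symm_apply e a).symm
    have hv0 : ((toAdd (e.symm a) : periodSubgroup n) : Site 3) = 0 := by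
      have h1 : ((e (e.symm a) : L.range) : N.graph ≃g N.graph) w = w := by rw [← ha]; exact haw
      rw [he, shiftHom_apply] at h1
      simpa using h1
    have h1 : e.symm a = 1 := by
      apply toAdd.injective; apply Subtype.ext; simpa using hv0
    rw [ha, hc, h1, map_one]
  · -- rank two: `c (n₀e₀) = (n₀, 0)`, `c (n₁e₁) = (0, n₁)`
    refine ⟨e (ι _ (smul_ev_mem_periodLattice n 0)), e (ι _ (smul_ev_mem_periodLattice n 1)), ?_⟩
    rw [hc, hc, toAdd_projChar, toAdd_projChar, MaxArea.det2]
    have h0 := (hn 0).ne'; have h1 := (hn 1).ne'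
    simp [ι, proj, ev, h0, h1]

/-- **END-STATE CONTINUITY ⟹ `θ_x(p_c) = 0` at every vertex of every CONNECTED PERIODIC net on `ℤ³`** (`hE` is the explicit OPEN end-state statement, never asserted).
[cite: BenjaminiSchramm1996, Conj. 4; §2] -/
theorem criticalContinuity_of_conj4_endState (hE : BenjaminiSchramm1996_conj4_endState) {n : Fin 3 → ℕ} (h : N.Periodic n) (hn : ∀ i, 0 < n i)
    (hc : N.graph.Connected) (x : Site 3) : theta N.graph x (criticalProbIOf N.graph x) = 0 := by
  obtain ⟨A₀, reps, c, h1, h2, h3⟩ := N.exists_endState_input h hn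
  exact hE N.graph hc A₀ reps c h1 h2 h3 x

/-- **… in particular on every FLAT LINKED periodic net of planar range one** (connectedness from the frames-only skeleton of «SharpnessChiralSlabNet»; no symmetry).
[cite: BenjaminiSchramm1996, Conj. 4; §2] -/
theorem criticalContinuity_of_flat_of_conj4_endState (hE : BenjaminiSchramm1996_conj4_endState) (hF : N.Flat) (hL : N.Linked) (n : Fin 3 → ℕ)
    (hn : ∀ i, 0 < n i) (h : N.Periodic n) (planar : ∀ x, ∀ s ∈ N.stepsAt x, |s 0| ≤ 1 ∧ |s 1| ≤ 1) (x : Site 3) :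
    theta N.graph x (criticalProbIOf N.graph x) = 0 :=
  N.criticalContinuity_of_conj4_endState hE h hn (N.conj4_hypotheses_of_flat hF hL n hn h planar).1 x

end Z3Net

/-! ## §3 `G₈₈` is an end-state customer (with unit steps) -/

namespace ChiralNet

/-- **`θ_x(p_c) = 0` on the chiral slab net `G₈₈`, MODULO end-state continuity** — row 88's last column: the first layer of the end state (multi-type, UNIT steps) is where
`G₈₈` lives; nothing unconditional is claimed. [cite: BenjaminiSchramm1996, Conj. 4; §2 (quasi-transitive graphs)] -/
theorem criticalContinuity_of_conj4_endState (hE : BenjaminiSchramm1996_conj4_endState) (x : Site 3) :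
    theta chiralNet.graph x (criticalProbIOf chiralNet.graph x) = 0 :=
  chiralNet.criticalContinuity_of_flat_of_conj4_endState hE flat linked ![1, 1, 3] periods_pos periodic planar x

end ChiralNet

end Summit.CriticalPhenomena.PercolationContinuityZ3.Theorems.Transplant

end
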